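import Literature.AlgebraicGeometry.Resolution.ChowLemmaProofs
import Literature.AlgebraicGeometry.Resolution.ResolutionOfSingularities
import Literature.AlgebraicGeometry.Motives.ProjectiveDescentNormProofs
import Mathlib.AlgebraicGeometry.Morphisms.Immersion
import HarnessLib

/-!
# Finite subsets of a quasi-projective scheme lie in affine opens

Topic `Literature/AlgebraicGeometry/Resolution` (consumer: the Chow reduction of crux lines that need
`X` quasi-projective, e.g. `SeparableGalois.GaloisQuotientModels`). For a scheme `X` admitting an IMMERSION `ι : X ↪ ℙⁿ_k`
(a quasi-projective `k`-scheme) every finite set of points of `X` lies in an affine open subscheme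
(Mumford, *Abelian Varieties*, §7, Remark p. 69; Liu, *Algebraic Geometry and Arithmetic Curves*,
Prop. 3.3.36 (b)). The projective case (closed immersion) is
`IsProjectiveOver.finiteSubsetsInAffineOpens` (`SymmetricPowerProjective.lean`); the present file
does the locally closed case, which is what Chow's lemma (`ChowLemmaIntegral`) delivers.

Proof: the immersion factors as the closed immersion `ι.liftCoborder` into the open
`Ω = ι.coborderRange ⊆ ℙⁿ_k` (Mathlib); graded prime avoidance
(`GradedPrimeAvoidance.exists_form_basicOpen`, applied to the identity of `ℙⁿ_k`) gives a form `F`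
of positive degree with `ι(S) ⊆ D₊(F) ⊆ Ω`; `D₊(F)` is affine, hence so is the open `D₊(F)` of `Ω`
and its preimage `ι⁻¹ D₊(F)` under the closed (affine) immersion `ι.liftCoborder`.

## References
* D. Mumford, *Abelian Varieties* (1970), §7, Remark p. 69. [MumfordAV1970]
* Q. Liu, *Algebraic Geometry and Arithmetic Curves* (2002), Prop. 3.3.36 (b). [Liu2002]
-/

noncomputable section

open CategoryTheory AlgebraicGeometry TopologicalSpace

namespace Literature.AlgebraicGeometry.Resolution

universe u

/-- **Finite subsets of a scheme immersed in `ℙⁿ_k` lie in affine opens** (Mumford AV §7 Rem.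
p. 69; Liu 3.3.36 (b)): for an immersion `ι : X ⟶ ℙⁿ_k` and a finite `S ⊆ X` there is an affine
open `U ⊆ X` containing `S` — namely `ι⁻¹ D₊(F)` for a form `F` of positive degree through no point
of `ι(S)` and vanishing on the boundary of `ι(X)` (graded prime avoidance).
[cite: Liu2002, Prop. 3.3.36 (b)] -/
theorem exists_isAffineOpen_finset_subset_of_isImmersion {k : Type u} [Field k] {n : ℕ}
    {X : Scheme.{u}} (ι : X ⟶ (Motives.projectiveSpace n k).left) [IsImmersion ι]
    (S : Finset X) : ∃ U : X.Opens, IsAffineOpen U ∧ (↑S : Set X) ⊆ U := by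
  classical
  let 𝒜 := MvPolynomial.homogeneousSubmodule (Fin (n + 1)) k
  letI : GradedAlgebra 𝒜 := MvPolynomial.gradedAlgebra (σ := Fin (n + 1)) (R := k)
  let r : X ⟶ Proj 𝒜 := ι
  haveI : IsImmersion r := inferInstanceAs (IsImmersion ι)
  have hΩ : ∀ t ∈ S.image r.base, t ∈ r.coborderRange := by
    intro t ht
    obtain ⟨x, -, rfl⟩ := Finset.mem_image.mp ht
    exact subset_coborder ⟨x, rfl⟩
  obtain ⟨m, F, hm, hF, hT, hle⟩ := Motives.GradedPrimeAvoidance.exists_form_basicOpen 𝒜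
    (𝟙 (Proj 𝒜)) Function.injective_id IsClosedMap.id (S.image r.base) r.coborderRange hΩ
  have hle' : Proj.basicOpen 𝒜 F ≤ r.coborderRange := by simpa using hle
  refine ⟨r ⁻¹ᵁ Proj.basicOpen 𝒜 F, ?_, ?_⟩
  · have hD : IsAffineOpen (Proj.basicOpen 𝒜 F) := Proj.isAffineOpen_basicOpen 𝒜 F hF hm
    have hV : IsAffineOpen (r.coborderRange.ι ⁻¹ᵁ Proj.basicOpen 𝒜 F) := by
      rw [← r.coborderRange.ι.isAffineOpen_iff_of_isOpenImmersion,
        Scheme.Hom.image_preimage_eq_opensRange_inf, Scheme.Opens.opensRange_ι,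
        inf_eq_right.mpr hle']
      exact hD
    have hpre : r.liftCoborder ⁻¹ᵁ (r.coborderRange.ι ⁻¹ᵁ Proj.basicOpen 𝒜 F) =
        r ⁻¹ᵁ Proj.basicOpen 𝒜 F := by
      rw [← Scheme.Hom.comp_preimage, Scheme.Hom.liftCoborder_ι]
    rw [← hpre]
    exact hV.preimage r.liftCoborder
  · intro x hx
    exact hT (r.base x) (Finset.mem_image_of_mem _ hx)

/-- **Chow + graded prime avoidance**: every integral separated scheme of finite type over a field
receives a proper birational morphism from an integral scheme, separated and of finite type over the
field, all of whose finite subsets lie in affine opens (the quasi-projective Chow cover,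
`ChowLemmaIntegral`, proved in tree, followed by
`exists_isAffineOpen_finset_subset_of_isImmersion`). [cite: GortzWedhorn2020, Thm 13.100] -/
theorem exists_isBirational_finsetsInAffineOpens {k : Type u} [Field k] (X : Scheme.{u})
    [IsIntegral X] (f : X ⟶ Spec (.of k)) [IsSeparated f] [LocallyOfFiniteType f]
    [QuasiCompact f] :
    ∃ (X' : Scheme.{u}) (_ : IsIntegral X') (π : X' ⟶ X), IsProper π ∧
      IsBirational π ∧
      (∀ S : Finset X', ∃ U : X'.Opens, IsAffineOpen U ∧ (↑S : Set X') ⊆ U) := by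
  obtain ⟨m, X', π, ι, hiX, hι, hπ, -, -, hbir⟩ :=
    ChowLemmaIntegral_holds k X f ‹_› ‹_› ‹_› ‹_›
  haveI := hι
  exact ⟨X', hiX, π, hπ, hbir, exists_isAffineOpen_finset_subset_of_isImmersion ι⟩

end Literature.AlgebraicGeometry.Resolution

end
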